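import Summits.MatrixMultiplication.MatrixMultiplication.Theses.SnSubsetDichotomy
import Summits.MatrixMultiplication.MatrixMultiplication.Theorems.SnSubsetDichotomyGlobalBranchStubDimGrowthPeel
import Literature.NumberTheory.DiophantineGeometry.PartitionTableaux
import Literature.NumberTheory.DiophantineGeometry.FirstRowPeeling

/-!
# Stub `stub_dimGrowth` (crux stmt-MatrixMultiplication-8303, line flat-tail-truncation)

Crux `Summit.MatrixMultiplication.MatrixMultiplication.Theses.SnSubsetDichotomy.GlobalBranch`, line
`flat-tail-truncation`: the dimension growth of the Wedderburn blocks of `ℂ[𝔖ₙ]` away from the two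
ends of the dominance order. For `μ ⊢ n` write `μ₁ = μ.parts.sup` (first row) and
`μ₁' = card μ.parts` (first column). We prove (`stub_dimGrowth`): with `c = 1/20` and `n₁ = 400`,
for `n ≥ n₁` every `μ ⊢ n` with `⌊√n⌋ < n - max (μ₁, μ₁')` has
`f^μ = numStandardTableaux μ ≥ exp (c √n)`.

Proof. By transposition (`f^{μᵀ} = f^μ`, `(μᵀ)₁ = μ₁'`, `card μᵀ.parts = μ₁`) we may assume
`μ₁ ≥ μ₁'`, so `μ₁² ≥ μ₁ μ₁' ≥ n`. Peel the first row, `μ = (a, ν)`, `ν ⊢ m = n - a`, `b = ν₁`,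
`t = μ₁' - 1`; the division-free peeling bounds of `…StubDimGrowthPeel.lean`,
(A) `C(n, m) ≤ f^μ · C(a + t, t)` and (B) `C(n, m) · ∏_{s<b} (a - s) ≤ f^μ · ∏_{s<b} (a - s + t)`,
give `f^μ ≥ (n/m)^{m-t} ≥ exp ((m - t) a / n)` (A; `C(a+t,t) (n/m)^{m-t} ≤ C(n,m)`,
`exp (a/n) ≤ n/m`) and `f^μ ≥ C(n, m) θ^b` for `θ = a/(a + 2t)` when `2b ≤ a` (B). With
`b + t ≤ m + 1`, `t + 1 ≤ a`, `√n < m`, `√n ≤ a`, the estimate `exp (√n/20) ≤ f^μ` follows in four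
cases: `2t ≤ m` (A); `2t > m`, `2b ≤ a`, `2m ≤ n` (B, `θ ≥ exp (-2t/a)`, `C(n,m) ≥ 2^m`);
`2t > m`, `2b ≤ a`, `2m > n` (B, `θ ≥ 1/3`, `C(n,m) = C(n,a) ≥ 2^a`); `2t > m`, `2b > a` (A).
-/

set_option linter.dupNamespace false

open scoped BigOperators Matrix ComplexOrder
open Finset
open Literature.NumberTheory.DiophantineGeometry (numStandardTableaux spechtCharacter)

namespace Summit.MatrixMultiplication.MatrixMultiplication.Theorems.GlobalBranch

open Literature.NumberTheory.DiophantineGeometry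

section DimGrowth

variable {n m a : ℕ} {μ : Nat.Partition n} {ν : Nat.Partition m}

/-! ### The bounds (A) and (B) in exponential form -/

/-- **(A)**: `exp ((m - t) a / n) ≤ f^μ`, from `(n/m)^{m-t} ≤ C(n,m)/C(a+t,t) ≤ f^μ` and
`exp (a/n) ≤ n/m` (`1 - a/n ≤ exp (-a/n)`). [folklore] -/
theorem dimGrowth_exp_boundA (hs : μ.sortedParts = a :: ν.sortedParts)
    (ht : ν.youngDiagram.colLen 0 ≤ m) (hm : 0 < m) :
    Real.exp (((m - ν.youngDiagram.colLen 0 : ℕ) : ℝ) * ((a : ℝ) / n)) ≤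
      (numStandardTableaux μ : ℝ) := by
  set t := ν.youngDiagram.colLen 0 with ht_def
  have hnm : a + m = n := add_eq_of_sortedParts_eq_cons hs
  have h1 : (n.choose m : ℝ) ≤ (numStandardTableaux μ : ℝ) * ((a + t).choose t : ℝ) := by
    exact_mod_cast dimGrowth_choose_le_mul_choose hs
  have h2 := dimGrowth_choose_mul_pow_le_choose (a := a) ht
  rw [hnm] at h2
  have hC : (0 : ℝ) < ((a + t).choose t : ℝ) := by
    exact_mod_cast Nat.choose_pos (Nat.le_add_left t a)
  have hm0 : (0 : ℝ) < m := by exact_mod_cast hm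
  have hn0 : (0 : ℝ) < n := by exact_mod_cast (show 0 < n by omega)
  have hexp : Real.exp ((a : ℝ) / n) ≤ (n : ℝ) / m := by
    rw [le_div_iff₀ hm0]
    have h3 := Real.add_one_le_exp (-((a : ℝ) / n))
    have h4 : (n : ℝ) * (-((a : ℝ) / n) + 1) = m := by
      have e : (a : ℝ) + m = n := by exact_mod_cast hnm
      field_simp
      linarith
    calc Real.exp ((a : ℝ) / n) * m = Real.exp ((a : ℝ) / n) * (n * (-((a : ℝ) / n) + 1)) := by
          rw [h4]
      _ ≤ Real.exp ((a : ℝ) / n) * (n * Real.exp (-((a : ℝ) / n))) := by gcongr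
      _ = n := by rw [mul_left_comm, ← Real.exp_add, add_neg_cancel, Real.exp_zero, mul_one]
  calc Real.exp (((m - t : ℕ) : ℝ) * ((a : ℝ) / n))
      = Real.exp ((a : ℝ) / n) ^ (m - t) := Real.exp_nat_mul _ _
    _ ≤ ((n : ℝ) / m) ^ (m - t) := pow_le_pow_left₀ (Real.exp_nonneg _) hexp _
    _ ≤ (numStandardTableaux μ : ℝ) :=
        le_of_mul_le_mul_left ((h2.trans h1).trans_eq (mul_comm _ _)) hC

/-- **(B)**: `C(n, m) · θ^b ≤ f^μ` whenever `0 ≤ θ` and `θ (a - s + t) ≤ a - s` for all `s < b`.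
[folklore] -/
theorem dimGrowth_choose_mul_pow_le_of_fac (hs : μ.sortedParts = a :: ν.sortedParts) {θ : ℝ}
    (hθ : 0 ≤ θ)
    (hfac : ∀ s ∈ Finset.range (ν.youngDiagram.rowLen 0),
      θ * ((a - s + ν.youngDiagram.colLen 0 : ℕ) : ℝ) ≤ ((a - s : ℕ) : ℝ)) :
    (n.choose m : ℝ) * θ ^ ν.youngDiagram.rowLen 0 ≤ (numStandardTableaux μ : ℝ) := by
  set b := ν.youngDiagram.rowLen 0 with hb_def
  set t := ν.youngDiagram.colLen 0 with ht_def
  have hba : b ≤ a := dimGrowth_rowLen_body_le hs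
  have h1 : (n.choose m : ℝ) * ∏ s ∈ Finset.range b, ((a - s : ℕ) : ℝ) ≤
      (numStandardTableaux μ : ℝ) * ∏ s ∈ Finset.range b, ((a - s + t : ℕ) : ℝ) := by
    exact_mod_cast dimGrowth_choose_mul_prod_le hs
  have hD : (0 : ℝ) < ∏ s ∈ Finset.range b, ((a - s + t : ℕ) : ℝ) :=
    Finset.prod_pos fun s hs => by
      exact_mod_cast (show 0 < a - s + t by have := Finset.mem_range.1 hs; omega)
  have hpow : θ ^ b = ∏ _s ∈ Finset.range b, θ := by
    rw [Finset.prod_const, Finset.card_range]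
  have h2 : θ ^ b * ∏ s ∈ Finset.range b, ((a - s + t : ℕ) : ℝ) ≤
      ∏ s ∈ Finset.range b, ((a - s : ℕ) : ℝ) := by
    rw [hpow, ← Finset.prod_mul_distrib]
    exact Finset.prod_le_prod (fun s _ => mul_nonneg hθ (Nat.cast_nonneg _)) hfac
  refine le_of_mul_le_mul_right ?_ hD
  calc (n.choose m : ℝ) * θ ^ b * ∏ s ∈ Finset.range b, ((a - s + t : ℕ) : ℝ)
      = (n.choose m : ℝ) * (θ ^ b * ∏ s ∈ Finset.range b, ((a - s + t : ℕ) : ℝ)) := by ring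
    _ ≤ (n.choose m : ℝ) * ∏ s ∈ Finset.range b, ((a - s : ℕ) : ℝ) :=
        mul_le_mul_of_nonneg_left h2 (Nat.cast_nonneg _)
    _ ≤ _ := h1

/-- The factor test for `θ = a/(a + 2t)` when `2b ≤ a`: `a (a - s + t) ≤ (a - s)(a + 2t)` for
`s < b`, i.e. `a t ≤ 2t (a - s)`. [folklore] -/
theorem dimGrowth_fac {a b t s : ℕ} (h2b : 2 * b ≤ a) (hs : s ∈ Finset.range b) :
    (a : ℝ) / (a + 2 * t) * ((a - s + t : ℕ) : ℝ) ≤ ((a - s : ℕ) : ℝ) := by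
  rw [Finset.mem_range] at hs
  have ha : (0 : ℝ) < a := by exact_mod_cast (show 0 < a by omega)
  have hat : (0 : ℝ) < (a : ℝ) + 2 * t := by positivity
  have h2D : (a : ℝ) ≤ 2 * ((a - s : ℕ) : ℝ) := by
    exact_mod_cast (show a ≤ 2 * (a - s) by omega)
  rw [div_mul_eq_mul_div, div_le_iff₀ hat, Nat.cast_add]
  nlinarith [mul_le_mul_of_nonneg_right h2D (Nat.cast_nonneg t), Nat.cast_nonneg (α := ℝ) (a - s)]

/-- **(B), first instance** (`2m ≤ n`, `2b ≤ a`): `exp (m log 2 - 2tb/a) ≤ f^μ`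
(`C(n,m) ≥ (n/m)^m ≥ 2^m` and `θ = exp (-2t/a)`). [folklore] -/
theorem dimGrowth_exp_boundB1 (hs : μ.sortedParts = a :: ν.sortedParts) (h2m : 2 * m ≤ n)
    (hm : 0 < m) (h2b : 2 * ν.youngDiagram.rowLen 0 ≤ a) :
    Real.exp ((m : ℝ) * Real.log 2 +
        (ν.youngDiagram.rowLen 0 : ℝ) * (-(2 * (ν.youngDiagram.colLen 0 : ℝ) / a))) ≤
      (numStandardTableaux μ : ℝ) := by
  set b := ν.youngDiagram.rowLen 0 with hb_def
  set t := ν.youngDiagram.colLen 0 with ht_def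
  have hnm : a + m = n := add_eq_of_sortedParts_eq_cons hs
  have ha0 : (0 : ℝ) < a := by exact_mod_cast (show 0 < a by omega)
  have ha0' : (a : ℝ) ≠ 0 := ha0.ne'
  have hθ0 : (0 : ℝ) ≤ (a : ℝ) / (a + 2 * t) := by positivity
  have hB := dimGrowth_choose_mul_pow_le_of_fac hs hθ0 (fun s hs' => dimGrowth_fac h2b hs')
  have hθ : Real.exp (-(2 * (t : ℝ) / a)) ≤ (a : ℝ) / (a + 2 * t) := by
    rw [Real.exp_neg, inv_eq_one_div, div_le_div_iff₀ (Real.exp_pos _) (by positivity), one_mul]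
    have h1 := Real.add_one_le_exp (2 * (t : ℝ) / a)
    have h2 : (a : ℝ) + 2 * t = a * (2 * (t : ℝ) / a + 1) := by
      field_simp
      ring
    rw [h2]
    exact mul_le_mul_of_nonneg_left h1 ha0.le
  have hm0 : (0 : ℝ) < m := by exact_mod_cast hm
  have h2 : (2 : ℝ) ≤ (n : ℝ) / m := by
    rw [le_div_iff₀ hm0]
    exact_mod_cast h2m
  have hC : (2 : ℝ) ^ m ≤ (n.choose m : ℝ) :=
    calc (2 : ℝ) ^ m ≤ ((n : ℝ) / m) ^ m := pow_le_pow_left₀ (by norm_num) h2 m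
      _ ≤ (n.choose m : ℝ) := by
          rw [← hnm]
          exact dimGrowth_pow_le_choose a m
  rw [Real.exp_add, Real.exp_nat_mul, Real.exp_nat_mul, Real.exp_log two_pos]
  calc (2 : ℝ) ^ m * Real.exp (-(2 * (t : ℝ) / a)) ^ b
      ≤ (n.choose m : ℝ) * ((a : ℝ) / (a + 2 * t)) ^ b :=
        mul_le_mul hC (pow_le_pow_left₀ (Real.exp_nonneg _) hθ b) (by positivity)
          (Nat.cast_nonneg _)
    _ ≤ _ := hB

/-- **(B), second instance** (`n < 2m`, `2b ≤ a`, `t + 1 ≤ a`): `exp (a log 2 - b log 3) ≤ f^μ`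
(`C(n,m) = C(n,a) ≥ (n/a)^a ≥ 2^a` and `θ = 1/3`). [folklore] -/
theorem dimGrowth_exp_boundB2 (hs : μ.sortedParts = a :: ν.sortedParts) (h2m : n < 2 * m)
    (h2b : 2 * ν.youngDiagram.rowLen 0 ≤ a) (hta : ν.youngDiagram.colLen 0 + 1 ≤ a) :
    Real.exp ((a : ℝ) * Real.log 2 + (ν.youngDiagram.rowLen 0 : ℝ) * (-Real.log 3)) ≤
      (numStandardTableaux μ : ℝ) := by
  set b := ν.youngDiagram.rowLen 0 with hb_def
  set t := ν.youngDiagram.colLen 0 with ht_def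
  have hnm : a + m = n := add_eq_of_sortedParts_eq_cons hs
  have ha0 : (0 : ℝ) < a := by exact_mod_cast (show 0 < a by omega)
  have hθ0 : (0 : ℝ) ≤ (a : ℝ) / (a + 2 * t) := by positivity
  have hB := dimGrowth_choose_mul_pow_le_of_fac hs hθ0 (fun s hs' => dimGrowth_fac h2b hs')
  have hθ : (1 / 3 : ℝ) ≤ (a : ℝ) / (a + 2 * t) := by
    rw [div_le_div_iff₀ (by norm_num) (by positivity)]
    have h : (t : ℝ) + 1 ≤ a := by exact_mod_cast hta
    linarith
  have h2 : (2 : ℝ) ≤ (n : ℝ) / a := by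
    rw [le_div_iff₀ ha0]
    exact_mod_cast (show 2 * a ≤ n by omega)
  have hC : (2 : ℝ) ^ a ≤ (n.choose m : ℝ) :=
    calc (2 : ℝ) ^ a ≤ ((n : ℝ) / a) ^ a := pow_le_pow_left₀ (by norm_num) h2 a
      _ ≤ (n.choose a : ℝ) := by
          rw [← hnm, Nat.add_comm a m]
          exact dimGrowth_pow_le_choose m a
      _ = (n.choose m : ℝ) := by rw [← hnm, Nat.choose_symm_add]
  rw [Real.exp_add, Real.exp_nat_mul, Real.exp_nat_mul, Real.exp_log two_pos, Real.exp_neg,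
    Real.exp_log (by norm_num : (0 : ℝ) < 3), inv_eq_one_div]
  calc (2 : ℝ) ^ a * (1 / 3 : ℝ) ^ b ≤ (n.choose m : ℝ) * ((a : ℝ) / (a + 2 * t)) ^ b :=
        mul_le_mul hC (pow_le_pow_left₀ (by norm_num) hθ b) (by positivity) (Nat.cast_nonneg _)
    _ ≤ _ := hB

/-! ### The four real-arithmetic endgames (`c = 1/20`) -/

/-- Case `2t ≤ m`: `√n/20 ≤ (m - t) a/n` from `√n ≤ a`, `√n ≤ m`. [folklore] -/
theorem dimGrowth_arith_A1 {n a m t : ℕ} (hnm : a + m = n) (h2t : 2 * t ≤ m)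
    (ha : Real.sqrt n ≤ a) (hm : Real.sqrt n ≤ m) :
    (1 / 20 : ℝ) * Real.sqrt n ≤ ((m - t : ℕ) : ℝ) * ((a : ℝ) / n) := by
  rcases Nat.eq_zero_or_pos n with rfl | hn
  · simp
  have hn0 : (0 : ℝ) < n := by exact_mod_cast hn
  have hmt : ((m - t : ℕ) : ℝ) = (m : ℝ) - t := by rw [Nat.cast_sub (by omega)]
  rw [hmt, ← mul_div_assoc, le_div_iff₀ hn0]
  have e : (a : ℝ) + m = n := by exact_mod_cast hnm
  have h2t' : 2 * (t : ℝ) ≤ m := by exact_mod_cast h2t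
  have p1 : Real.sqrt n * m ≤ a * m := mul_le_mul_of_nonneg_right ha (Nat.cast_nonneg m)
  have p2 : Real.sqrt n * a ≤ m * a := mul_le_mul_of_nonneg_right hm (Nat.cast_nonneg a)
  have p3 : 2 * (t : ℝ) * a ≤ m * a := mul_le_mul_of_nonneg_right h2t' (Nat.cast_nonneg a)
  have p4 : (0 : ℝ) ≤ m * a := by positivity
  have p5 : Real.sqrt n * n = Real.sqrt n * a + Real.sqrt n * m := by rw [← mul_add, e]
  nlinarith [p1, p2, p3, p4, p5]

/-- Case `2t > m`, `2b > a`: `√n/20 ≤ (m - t) a/n` from `m - t ≥ b - 1 ≥ (a-1)/2` and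
`n ≤ 3a - 3`. [folklore] -/
theorem dimGrowth_arith_A2 {n a m t b : ℕ} (hnm : a + m = n) (h2t : m < 2 * t)
    (h2b : a < 2 * b) (hbt : b + t ≤ m + 1) (hta : t + 1 ≤ a) :
    (1 / 20 : ℝ) * Real.sqrt n ≤ ((m - t : ℕ) : ℝ) * ((a : ℝ) / n) := by
  have hD : a ≤ 2 * (m - t) + 1 := by omega
  have h3a : n + 3 ≤ 3 * a := by omega
  have hn : 1 ≤ n := by omega
  have hn0 : (0 : ℝ) < n := by exact_mod_cast hn
  rw [← mul_div_assoc, le_div_iff₀ hn0]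
  have hD' : (a : ℝ) ≤ 2 * ((m - t : ℕ) : ℝ) + 1 := by exact_mod_cast hD
  have h3a' : (n : ℝ) + 3 ≤ 3 * a := by exact_mod_cast h3a
  have hn1 : (1 : ℝ) ≤ n := by exact_mod_cast hn
  have hsq : Real.sqrt n ≤ n := by
    rw [Real.sqrt_le_left (Nat.cast_nonneg n)]
    nlinarith
  have hD6 : (n : ℝ) / 6 ≤ ((m - t : ℕ) : ℝ) := by linarith
  have ha3 : (n : ℝ) / 3 ≤ a := by linarith
  have p1 : (n : ℝ) / 6 * ((n : ℝ) / 3) ≤ ((m - t : ℕ) : ℝ) * a :=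
    mul_le_mul hD6 ha3 (by positivity) (Nat.cast_nonneg _)
  have p2 : Real.sqrt n * n ≤ n * n := mul_le_mul_of_nonneg_right hsq (Nat.cast_nonneg n)
  have p3 : (0 : ℝ) ≤ n * n := by positivity
  nlinarith [p1, p2, p3]

/-- Case `2t > m`, `2b ≤ a`, `2m ≤ n`: `√n/20 ≤ m log 2 - 2tb/a` from `4tb ≤ (m+1)²`,
`a ≥ m > √n ≥ 20` and `log 2 > 0.693 > 1/2`. [folklore] -/
theorem dimGrowth_arith_B1 {n a m t b : ℕ} (hnm : a + m = n) (h2m : 2 * m ≤ n)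
    (hbt : b + t ≤ m + 1) (hm : Real.sqrt n < m) (h400 : 400 ≤ n) :
    (1 / 20 : ℝ) * Real.sqrt n ≤ (m : ℝ) * Real.log 2 + (b : ℝ) * (-(2 * (t : ℝ) / a)) := by
  have h20 : (20 : ℝ) ≤ Real.sqrt n := by
    rw [Real.le_sqrt (by norm_num) (Nat.cast_nonneg _)]
    have h : ((400 : ℕ) : ℝ) ≤ n := by exact_mod_cast h400
    norm_num at h ⊢
    exact h
  have hma : (m : ℝ) ≤ a := by exact_mod_cast (show m ≤ a by omega)
  have hm20 : (20 : ℝ) < m := lt_of_le_of_lt h20 hm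
  have ha0 : (0 : ℝ) < a := by linarith
  have hbt' : (b : ℝ) + t ≤ m + 1 := by exact_mod_cast hbt
  have hL : (0.6931471803 : ℝ) < Real.log 2 := Real.log_two_gt_d9
  set X : ℝ := (m : ℝ) * Real.log 2 - 1 / 20 * Real.sqrt n with hX
  have hX64 : 0.64 * (m : ℝ) ≤ X := by
    have p : (0.6931471803 : ℝ) * m ≤ Real.log 2 * m :=
      mul_le_mul_of_nonneg_right hL.le (Nat.cast_nonneg m)
    rw [hX]
    nlinarith [p, hm]
  have hq : ((b : ℝ) + t) ^ 2 ≤ ((m : ℝ) + 1) ^ 2 := pow_le_pow_left₀ (by positivity) hbt' 2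
  have h1 : 4 * ((t : ℝ) * b) ≤ ((m : ℝ) + 1) ^ 2 := by nlinarith [sq_nonneg ((b : ℝ) - t), hq]
  have key : 2 * ((t : ℝ) * b) ≤ a * X := by
    have p2 : 0.64 * (m : ℝ) * m ≤ X * m := mul_le_mul_of_nonneg_right hX64 (Nat.cast_nonneg m)
    have p3 : (m : ℝ) * X ≤ a * X := mul_le_mul_of_nonneg_right hma (by linarith)
    have p4 : (20 : ℝ) * m ≤ m * m := by nlinarith
    nlinarith [h1, p2, p3, p4]
  have hdiv : (b : ℝ) * (2 * (t : ℝ) / a) ≤ X := by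
    rw [← mul_div_assoc, div_le_iff₀ ha0]
    nlinarith [key]
  rw [hX] at hdiv
  nlinarith [hdiv]

/-- `log 3 ≤ 2 log 2 - 1/4` (`1 - 3/4 ≤ log (4/3)`). [folklore] -/
theorem dimGrowth_log_three_le : Real.log 3 ≤ 2 * Real.log 2 - 1 / 4 := by
  have h := Real.one_sub_inv_le_log_of_pos (show (0 : ℝ) < 4 / 3 by norm_num)
  have h4 : Real.log (4 / 3) = 2 * Real.log 2 - Real.log 3 := by
    rw [Real.log_div (by norm_num) (by norm_num), show (4 : ℝ) = 2 ^ 2 by norm_num, Real.log_pow]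
    push_cast
    ring
  rw [h4] at h
  norm_num at h
  linarith

/-- Case `2t > m`, `2b ≤ a`, `2m > n`: `√n/20 ≤ a log 2 - b log 3` from `b ≤ a/2`,
`log 3 ≤ 2 log 2 - 1/4` and `√n ≤ a`. [folklore] -/
theorem dimGrowth_arith_B2 {n a b : ℕ} (h2b : 2 * b ≤ a) (ha : Real.sqrt n ≤ a) :
    (1 / 20 : ℝ) * Real.sqrt n ≤ (a : ℝ) * Real.log 2 + (b : ℝ) * (-Real.log 3) := by
  have hlog3 := dimGrowth_log_three_le
  have h2b' : 2 * (b : ℝ) ≤ a := by exact_mod_cast h2b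
  have hl3 : 0 < Real.log 3 := Real.log_pos (by norm_num)
  have hs0 := Real.sqrt_nonneg (n : ℝ)
  have p1 : (b : ℝ) * Real.log 3 ≤ (a : ℝ) / 2 * Real.log 3 :=
    mul_le_mul_of_nonneg_right (by linarith) hl3.le
  have p2 : (a : ℝ) / 2 * Real.log 3 ≤ (a : ℝ) / 2 * (2 * Real.log 2 - 1 / 4) :=
    mul_le_mul_of_nonneg_left hlog3 (by positivity)
  nlinarith [p1, p2]

/-! ### Assembly -/

/-- **Core estimate** for `μ = (a, ν)`, `ν ⊢ m`, with `t + 1 ≤ a` rows, `n ≤ a (t+1)`,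
`⌊√n⌋ < m` and `n ≥ 400`: `exp (√n/20) ≤ f^μ`. [folklore] -/
theorem dimGrowth_core (hs : μ.sortedParts = a :: ν.sortedParts) (h400 : 400 ≤ n)
    (hta : ν.youngDiagram.colLen 0 + 1 ≤ a) (hnle : n ≤ a * (ν.youngDiagram.colLen 0 + 1))
    (hlev : Nat.sqrt n < m) :
    Real.exp ((1 / 20 : ℝ) * Real.sqrt n) ≤ (numStandardTableaux μ : ℝ) := by
  set b := ν.youngDiagram.rowLen 0 with hb_def
  set t := ν.youngDiagram.colLen 0 with ht_def
  have hnm : a + m = n := add_eq_of_sortedParts_eq_cons hs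
  have hm0 : m ≠ 0 := by omega
  have hbt : b + t ≤ m + 1 := dimGrowth_rowLen_add_colLen_le ν
  have hb1 : 0 < b := dimGrowth_rowLen_pos ν hm0
  have htm : t ≤ m := by omega
  have hsqm : Real.sqrt n < m := by
    have h1 : (n : ℝ) < ((Nat.sqrt n + 1 : ℕ) : ℝ) ^ 2 := by exact_mod_cast Nat.lt_succ_sqrt' n
    have h2 : Real.sqrt n < ((Nat.sqrt n + 1 : ℕ) : ℝ) := (Real.sqrt_lt' (by positivity)).2 h1
    have h3 : ((Nat.sqrt n + 1 : ℕ) : ℝ) ≤ m := by exact_mod_cast hlev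
    exact h2.trans_le h3
  have hsqa : Real.sqrt n ≤ a := by
    rw [Real.sqrt_le_left (Nat.cast_nonneg a), sq]
    exact_mod_cast hnle.trans (Nat.mul_le_mul_left a hta)
  rcases le_or_gt (2 * t) m with h1 | h1
  · exact (Real.exp_le_exp.2 (dimGrowth_arith_A1 hnm h1 hsqa hsqm.le)).trans
      (dimGrowth_exp_boundA hs htm (Nat.pos_of_ne_zero hm0))
  · rcases le_or_gt (2 * b) a with h2 | h2
    · rcases le_or_gt (2 * m) n with h3 | h3
      · exact (Real.exp_le_exp.2 (dimGrowth_arith_B1 hnm h3 hbt hsqm h400)).trans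
          (dimGrowth_exp_boundB1 hs h3 (Nat.pos_of_ne_zero hm0) h2)
      · exact (Real.exp_le_exp.2 (dimGrowth_arith_B2 h2 hsqa)).trans
          (dimGrowth_exp_boundB2 hs h3 h2 hta)
    · exact (Real.exp_le_exp.2 (dimGrowth_arith_A2 hnm h1 h2 hbt hta)).trans
        (dimGrowth_exp_boundA hs htm (Nat.pos_of_ne_zero hm0))

/-- **Main estimate, `μ₁ ≥ μ₁'`**: for `n ≥ 400` and `μ ⊢ n` with `card μ.parts ≤ μ.parts.sup` and
`⌊√n⌋ < n - μ.parts.sup`, `exp (√n/20) ≤ f^μ`. [folklore] -/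
theorem dimGrowth_main (h400 : 400 ≤ n) (μ : Nat.Partition n)
    (hra : Multiset.card μ.parts ≤ μ.parts.sup) (hlev : Nat.sqrt n < n - μ.parts.sup) :
    Real.exp ((1 / 20 : ℝ) * Real.sqrt n) ≤ (numStandardTableaux μ : ℝ) := by
  have hn0 : n ≠ 0 := by omega
  obtain ⟨ν, hs⟩ := exists_sortedParts_eq_sup_cons μ hn0
  have hcard := dimGrowth_card_parts_eq hs
  have hnle := dimGrowth_le_sup_mul_card μ
  rw [hcard] at hra hnle
  exact dimGrowth_core hs h400 hra hnle hlev

end DimGrowth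

/-- **Dimension growth beyond two-ended level `⌊√n⌋`** (stub `stub_dimGrowth` of the line
`flat-tail-truncation`): with `c = 1/20` and `n₁ = 400`, every `μ ⊢ n`, `n ≥ n₁`, whose first row
`μ₁` and first column `μ₁'` both satisfy `⌊√n⌋ < n - max (μ₁, μ₁')` has
`f^μ = numStandardTableaux μ ≥ exp (c √n)` (first-row peeling of the hook length formula, the
binomial estimate `(n/m)^m ≤ C(n,m)`, and transposition `f^{μᵀ} = f^μ`). -/
theorem stub_dimGrowth :
    ∃ c : ℝ, 0 < c ∧ ∃ n₁ : ℕ, ∀ n ≥ n₁, ∀ μ : Nat.Partition n,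
      Nat.sqrt n < n - max μ.parts.sup (Multiset.card μ.parts) →
        Real.exp (c * Real.sqrt (n : ℝ)) ≤ (numStandardTableaux μ : ℝ) := by
  refine ⟨1 / 20, by norm_num, 400, fun n hn μ hlev => ?_⟩
  rcases le_total (Multiset.card μ.parts) μ.parts.sup with hra | har
  · rw [max_eq_left hra] at hlev
    exact dimGrowth_main hn μ hra hlev
  · rw [max_eq_right har] at hlev
    rw [← dimGrowth_numStandardTableaux_transpose μ]
    exact dimGrowth_main hn μ.transpose
      (by rwa [dimGrowth_card_parts_transpose, dimGrowth_sup_parts_transpose])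
      (by rwa [dimGrowth_sup_parts_transpose])

end Summit.MatrixMultiplication.MatrixMultiplication.Theorems.GlobalBranch
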